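import Summits.QuantumFields.BalabanUV.T4Continuum.Support.NE9HoloFamilyCoupledEndSharp2

/-!
# NE9HoloFamilyTwoRadiiEnd — route R4♯ AT THE RECORD WITH BOTH HALVES IN LETTERS, TWO RADII: the chain roomed on the WHOLE
# table ball `‖Q‖ < R₀` (rate `θ`), the coupling half `hlast` DERIVED on the INNER ball `‖Q‖ < s₀` (E134 §1, any `θ₀ < 1` there)
# — the refuter's O-v11-1 (E132 §5 ∘ E134 §1); the off-centre twin (A-v11-1) rides in `NE9HoloFamilyOffCentreEnd`

Cell `pub-balaban`, T4-DAG §6 NE9; BINDER row NE9 OWNER lineage `b2b-balaban-t4-ne9-p1` gen 62, CRUX PROVER NE9 (ruling e34b3e0c (2));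
route R4 ∕ R4♯ ∕ R4♯-T of `t4/ROUTES-NE9.md` v10 (rank 1).  THE OWNER's ANSWER IN KERNEL TO THE REFUTER's PRICING-NE9 v11 §F-v11-1:
«E134 §3 ∕ E131 §5 AS FILED are ONE-RADIUS ENDs roomed on the inner ball — rate θ(σ), σ = s₀∕R₀; the rate of record θ(R₀) WITH both
halves in letters is the TWO-RADII composite E132 §7 ∘ E134 §1 … both pieces accepted, ≈ 40 l. unfiled = O-v11-1» and A-v11-1 «cut
the off-centre coupled END TWO-RADII (chain rooms split at R₀; E134 §1 BY NAME at (s₀, θ′)), else the displayed λ is λ*(σ) not λ*(1)».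
READING [analysis of the kernel, not of print]: `LastCouplingLipschitz E W T Ψ κ lam` is a property of the functional alone; E134 §1
derives it from the coupling two-point `hCup` on `ball 0 s₀` + the occupation of the record's tables in that ball, which needs a room AT
`s₀` (`ω̂·s₀ + τ̄·(2B + p̄₀) ≤ θ₀·s₀`, any `θ₀ < 1`); the CHAIN (table half) runs on the whole ball `‖Q‖ < R₀` under `PotentialKPG … R₀`
with its own room AT `R₀`.  The two rooms are independent letters; THIS FILE composes them: §1 centred (E132 §5 at `R₀` with `hlast :=`
E134 §1 at `s₀`), §2 at `ΨOf`; the off-centre twin (K2 §1 at `R₀` with the same `hlast`, rate `μ`) is `NE9HoloFamilyOffCentreEnd` §2∕§4.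

HONEST FRAMING (T4-DAG PAGE 1).  Rung (B)+1 of the FINITE-VOLUME T⁴ programme — NOT infinite volume, NOT a mass gap, NOT Clay.  NE9
(`T4OutputRate.NE9` ∧ `FadingMemory`) is a cell NEW ESTIMATE, NOT PRINTED in [I] = [Balaban1987RG1] (CMP **109**), [II] =
[Balaban1988RG2Cluster] (CMP **116**), NOT PROVED for Bałaban's E^{(j)}: every theorem below is «NE9 ⇐ the named binders»; displayed
Bałaban-side inputs EXACTLY E134 §2's — `PotentialKPG W act m a d R₀` (= (R-0)[scope] `PencilScope238`, displayed; TYPE [II]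
(2.14)∕(2.15) p. 15, (2.38) p. 20) + KP for `2m` (`hkp2`), `hdec`, `hpin`, `hΨv`∕`ΨOf`, `hexplZ`∕`hp₀` (TYPE [I] (2.14) p. 268 ∕ [II]
(2.41) p. 21), the coupling two-point `hCup` on `ball 0 s₀` + `clip` (NOT PRINTED as an inequality; [I] p. 263 «C^∞ … (or analytic)»),
the channel's coupling modulus `hTcup` + `qT` (TYPE [II] (1.33)–(1.36) p. 9), structural binders, and TWO ROOMS (at `s₀` and at `R₀`)
— nothing else.  W1 = model O-NE9-1 untouched; spine 0∕9.  HONEST DEPENDENCY (cell line,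
verbatim): continuum YM on T⁴ ⇐ BetaPertH ∧ nine spine estimates (0/9 proved); BetaPertH ⇐ (D1) ∧ (D4) ∧ CAP+tail; G-an2-4 gates
asym, D1 and NE2/3/4.  `FlowStep.BetaPertH`, (B), (B^μ) do not occur; [I]∕[II] for TYPES only (ABSOLUTE RULE).  0 def, 0 sorry.
A sharper RATE inside a CONDITIONAL END is not progress on the estimate itself.

CONTENT (composition by name):
* §1 **`ne9_and_fadingMemory_of_potentialKPG_coupling_twoRadii_SP_vac`** (O-v11-1) — E134 §2's binder list VERBATIM and in order with
  the inner room RENAMED `hroom₀ : ωh * s₀ + τbar * (2 * B + pbar) ≤ θ₀ * s₀`, `hθ₀1 : θ₀ < 1`, PLUS the outer room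
  `hroom : ωh * R₀ + τbar * (2 * B + pbar) ≤ θ * R₀`, `0 < θ < 1` ⊢ E134's moduli `ℓ = 2·clipbar·B + 2·B∕(R₀ − s₀)·qTbar` at rate `θ`
  (the rate of the WHOLE ball), prefactor `1∕(1−θ²)`.  E134 §2 is the case `θ₀ = θ` read at `s₀` (one radius).
* §2 **`…_coupling_twoRadii_psiOf`** at `Ψ := NE9EndApplied.ΨOf` (`rfl`) — THE R4♯ END AT THE RECORD WITH BOTH HALVES IN LETTERS, TWO
  RADII; §3 arithmetic `example` (outer room at `θ = 15∕26` on `R₀ = 1`, inner room at `θ₀ = 149∕247` on `s₀ = 19∕20`).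
WHAT THIS DOES NOT DO: discharge any displayed letter; choose `s₀`, `θ₀`, `θ` (instancer's dials; refuter's tables J∕K);
touch W1.  DISGUISE TEST: two `have`s and one `exact` per theorem over landed kernels; nothing of Bałaban's asserted.
References (TYPES only): [Balaban1987RG1] T. Bałaban, CMP **109** (1987) 249–301 — (0.23) p. 256, (1.18) p. 263, (2.13)–(2.14) p. 268;
[Balaban1988RG2Cluster] T. Bałaban, CMP **116** (1988) 1–22 — (1.33)–(1.36) p. 9, (2.14)–(2.15) p. 15, (2.38) p. 20, (2.40)–(2.41)
p. 21; [FV1980] T. Franzoni, E. Vesentini, North-Holland Math. Studies 40 (1980) ch. V §5.  Summits-side NEW work (LEAN PLACEMENT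
RULE); imports E134 `NE9HoloFamilyCoupledEndSharp2` (→ E132 `NE9HoloFamilyPotentialKPG`) BY NAME; modifies
nothing; 0 sorry.  Value = the one-radius∕two-radii distinction of the refuter's pricing made a kernel statement, NOT summit progress.
-/

noncomputable section

namespace Summit.QuantumFields.BalabanUV.T4Continuum.NE9HoloFamilyTwoRadiiEnd

open Metric Set ComplexConjugate
open scoped BigOperators ENNReal
open Literature.Probability.LatticeModels
open Literature.MathematicalPhysics.QuantumFieldTheory.Balaban1983to89
open Literature.MathematicalPhysics.QuantumFieldTheory.Balaban1983to89.T4OutputRate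
open Literature.MathematicalPhysics.QuantumFieldTheory.Balaban1983to89.T4ActivityLipschitz
open Literature.MathematicalPhysics.QuantumFieldTheory.Balaban1983to89.T4HistoryLipschitzRecursion
open Literature.MathematicalPhysics.QuantumFieldTheory.Balaban1983to89.T4HistoryLipschitzOuter
open Literature.MathematicalPhysics.QuantumFieldTheory.Balaban1983to89.T4HistoryLipschitzActivity
open Literature.MathematicalPhysics.QuantumFieldTheory.Balaban1983to89.T4HistoryLipschitzSegment
open Literature.MathematicalPhysics.QuantumFieldTheory.Balaban1983to89.T4HistoryLipschitzActivity (ClusterGeom)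
open Summit.QuantumFields.BalabanUV.T4Continuum.NE9TableReading
open Summit.QuantumFields.BalabanUV.T4Continuum.NE9HoloFamilyVacuumSubtracted (psiOf_eq_vac)
open Summit.QuantumFields.BalabanUV.T4Continuum.NE9HoloFamilyPotentialKPG (ne9_and_fadingMemory_of_potentialKPG_SP_vac)
open Summit.QuantumFields.BalabanUV.T4Continuum.NE9HoloFamilyCoupledEndSharp2 (lastCouplingLipschitz_of_couplingTwoPoint_room_sharp2)

variable {C : Carriers} (G : ClusterGeom C) {Bg : Type}

section Room

variable {ι : Type} [Nonempty ι] {E : Functional C Bg} {W : Set (ℕ → ℝ)} {Adm : Set (Bg → C.Dom → ℝ)}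
  {T : ℕ → (ℕ → ℝ) → (Bg → C.Dom → ℝ) → ι → ℝ} {Ψ : ℕ → ℝ → (ι → ℝ) → Bg → C.Dom → ℝ}
  {κ : ℝ} {wt : ℕ → ι → ℝ} {τ : ℕ → ℕ → ℝ} {τbar ω ωh : ℝ}

/-! ## §1 CENTRED, TWO RADII (O-v11-1): E132 §5 on `‖Q‖ < R₀` with `hlast :=` E134 §1 on `‖Q‖ < s₀` -/

/-- **ROUTE R4♯'s END OF RECORD, BOTH HALVES IN LETTERS, TWO RADII.**  E134 §2's hypotheses VERBATIM (structural binders; `hKP` +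
`hkp2` + `hdec` + `hpin`; `hΨv`; `hexplZ`∕`hp₀`; `hCup` on `ball 0 s₀`, `hclip0`∕`hclipb`; `hTcup`, `hqT0`∕`hqTb`; `0 < s₀ < R₀`) with its room
READ AS THE INNER ROOM `hroom₀ : ωh * s₀ + τbar * (2 * B + pbar) ≤ θ₀ * s₀` (`θ₀ < 1`; feeds ONLY the occupation behind `hlast`, E134 §1),
PLUS the OUTER room `hroom : ωh * R₀ + τbar * (2 * B + pbar) ≤ θ * R₀` (`0 < θ < 1`; feeds the chain on the whole ball, E132 §5).
Conclusion: `NE9 E W κ (prodModuli ((1∕(1−θ²))·ℓ) (fun _ => θ)) ∧ FadingMemory …`, `ℓ = 2·clipbar·B + 2·B∕(R₀ − s₀)·qTbar` — E134 §2's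
moduli at the WHOLE-BALL rate `θ` (E134 §2 itself = the case `θ₀ = θ` read at `s₀`).  «NE9 ⇐ the named binders».
[cite: Balaban1987RG1, (2.13)-(2.14) p.268 and p.263 (1.18); Balaban1988RG2Cluster, (1.33)-(1.36) p.9, (2.14)-(2.15) p.15, (2.38) p.20, (2.40)-(2.41) p.21; FV1980, ch.V §5] -/
theorem ne9_and_fadingMemory_of_potentialKPG_coupling_twoRadii_SP_vac
    (h0 : ∀ g ∈ W, ∀ (U : Bg) (X : C.Dom), C.scale X = 0 → E g U X = 0)
    (hAdm : AdmissibleTerms E W Adm) (hres : AdmRestrict Adm) (hadd : ChannelAdditive Adm T) (hloc : ChannelLocal Adm T)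
    (hstep : ChannelSizeAtStepNN Adm T κ wt τ) (hfac : Factorises E W T Ψ)
    (hsmul : ∀ (c : ℝ), ∀ H ∈ Adm, c • H ∈ Adm) (hne : Adm.Nonempty) (hwt : ∀ m y, 0 < wt m y)
    (hτ : ∀ k j, j ≤ k → 0 ≤ τ k j ∧ τ k j ≤ τbar * ω ^ (k - j)) (hτbar : 0 < τbar) (hω : 0 ≤ ω) (hωh : 0 < ωh)
    (hωωh : ω ≤ ωh)
    {act : ℕ → ℝ → Bg → lp (fun _ : ι => ℂ) ∞ → G.P → ℂ} {m : ℕ → ℝ → Bg → G.P → ℝ} {a d : G.P → ℝ}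
    {δ : C.Dom → ℝ} {U₀ : Bg} {explZ : ℕ → Bg → C.Dom → ℝ} {p₀ clip qT : ℕ → ℝ}
    {R₀ s₀ B pbar θ₀ θ clipbar qTbar : ℝ}
    (hs₀ : 0 < s₀) (hsR : s₀ < R₀) (hB : 0 ≤ B) (hpbar : 0 ≤ pbar) (hθ₀1 : θ₀ < 1) (hθ0 : 0 < θ) (hθ1 : θ < 1)
    (hKP : G.PotentialKPG W act m a d R₀)
    (hkp2 : ∀ g ∈ W, ∀ (k : ℕ) (U : Bg) (X : C.Dom), C.scale X = k + 1 →
      ∀ γ ∈ G.vol X, ∑ γ' ∈ G.vol X with G.inc γ' γ, 2 * m k (g k) U γ' * Real.exp (a γ' + d γ') ≤ a γ)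
    (hdec : G.DecayExtract δ d) (hpin : G.PinBudget a δ (fun _ => B) κ)
    (hΨv : ∀ (k : ℕ) (s : ℝ) (P : ι → ℝ) (U : Bg) (X : C.Dom),
      Ψ k s P U X = (G.newTerm act k s U X (reading (wt k) P)).re - (G.newTerm act k s U₀ X (reading (wt k) P)).re +
        explZ k U X)
    (hexplZ : ∀ (k : ℕ) (U : Bg) (X : C.Dom), C.scale X = k + 1 → |explZ k U X| ≤ Real.exp (-(κ * C.d X)) * p₀ k)
    (hp₀ : ∀ k, p₀ k ≤ pbar) (hclip0 : ∀ k, 0 ≤ clip k) (hclipb : ∀ k, clip k ≤ clipbar)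
    (hCup : ∀ g ∈ W, ∀ g' ∈ W, ∀ (k : ℕ) (U : Bg) (X : C.Dom), C.scale X = k + 1 →
      ∀ Q ∈ ball (0 : lp (fun _ : ι => ℂ) ∞) s₀, ∀ γ ∈ G.vol X,
        ‖act k (g k) U Q γ‖ ≤ m k (g' k) U γ ∧
          ‖act k (g k) U Q γ - act k (g' k) U Q γ‖ ≤ clip k * |g k - g' k| * m k (g' k) U γ)
    (hqT0 : ∀ k, 0 ≤ qT k) (hqTb : ∀ k, qT k ≤ qTbar)
    (hTcup : ∀ g ∈ W, ∀ g' ∈ W, ∀ (k : ℕ) (y : ι), |T k g (E g) y - T k g' (E g) y| ≤ wt k y * (qT k * |g k - g' k|))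
    (hroom₀ : ωh * s₀ + τbar * (2 * B + pbar) ≤ θ₀ * s₀) (hroom : ωh * R₀ + τbar * (2 * B + pbar) ≤ θ * R₀) :
    NE9 E W κ (prodModuli (1 / (1 - θ ^ 2) * (2 * clipbar * B + 2 * B / (R₀ - s₀) * qTbar)) fun _ => θ) ∧
      FadingMemory (1 / (1 - θ ^ 2) * (2 * clipbar * B + 2 * B / (R₀ - s₀) * qTbar) / θ) θ
        (prodModuli (1 / (1 - θ ^ 2) * (2 * clipbar * B + 2 * B / (R₀ - s₀) * qTbar)) fun _ => θ) := by
  -- the coupling half on the INNER ball (E134 §1), at the inner room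
  have hlast := lastCouplingLipschitz_of_couplingTwoPoint_room_sharp2 G h0 hAdm hres hadd hloc hstep hfac hsmul hne hwt hτ hτbar
    hω hωh hωωh hs₀ hsR hB hpbar hθ₀1 hKP hkp2 hdec hpin hΨv hexplZ hp₀ hclip0 hCup hqT0 hTcup hroom₀
  have hϱ : 0 < R₀ - s₀ := sub_pos.mpr hsR; have hclipbar : 0 ≤ clipbar := (hclip0 0).trans (hclipb 0)
  have hqTbar : 0 ≤ qTbar := (hqT0 0).trans (hqTb 0); have hc : 0 ≤ 2 * B / (R₀ - s₀) := by positivity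
  have hℓ : 0 ≤ 2 * clipbar * B + 2 * B / (R₀ - s₀) * qTbar := by positivity
  have hlam : ∀ k, 2 * clip k * B + 2 * B / (R₀ - s₀) * qT k ≤ 2 * clipbar * B + 2 * B / (R₀ - s₀) * qTbar := fun k =>
    add_le_add (by gcongr; exact hclipb k) (mul_le_mul_of_nonneg_left (hqTb k) hc)
  -- the table half on the WHOLE ball (E132 §5), at the outer room
  exact ne9_and_fadingMemory_of_potentialKPG_SP_vac G h0 hAdm hres hadd hloc hstep hfac hlast hsmul hne hwt hτ hτbar hω hωh hωωh
    (hs₀.trans hsR) hB hpbar hθ0 hθ1 hℓ hKP hdec hpin hΨv hexplZ hp₀ hroom hlam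

end Room

/-! ## §2 At the record's own new-term map `NE9EndApplied.ΨOf` (shape by `rfl`) -/

section Record

open Summit.QuantumFields.BalabanUV.T4Continuum.NE9EndApplied
open Summit.QuantumFields.BalabanUV.T4Continuum.NE9ComplexEncoding (doubleCarriers)

variable {C₀ : Carriers} {E : Type} {ι : Type}

omit G in
/-- **§2 — ROUTE R4♯'s END AT THE RECORD's OWN NEW-TERM MAP `ΨOf`, BOTH HALVES IN LETTERS, TWO RADII** — §1 at
`Ψ := NE9EndApplied.ΨOf G act wt U₀ explZ` (`rfl`): E134 §3's letters with the room read at `s₀` (inner, `θ₀`) AND at `R₀` (outer, `θ`),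
conclusion at the whole-ball rate `θ`.  «NE9 ⇐ the named binders».
[cite: Balaban1987RG1, (2.13)-(2.14) p.268 and (0.23) p.256, p.263; Balaban1988RG2Cluster, (1.33)-(1.36) p.9, (2.38) p.20, (2.40)-(2.41) p.21; FV1980, ch.V §5] -/
theorem ne9_and_fadingMemory_of_potentialKPG_coupling_twoRadii_psiOf [Nonempty ι] (G : ClusterGeom (doubleCarriers C₀))
    {Ef : Functional (doubleCarriers C₀) E} {W : Set (ℕ → ℝ)} {Adm : Set (E → (doubleCarriers C₀).Dom → ℝ)}
    {T : ℕ → (ℕ → ℝ) → (E → (doubleCarriers C₀).Dom → ℝ) → ι → ℝ} {κ : ℝ} {wt : ℕ → ι → ℝ} {τ : ℕ → ℕ → ℝ}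
    {τbar ω ωh : ℝ} {act : ℕ → ℝ → E → lp (fun _ : ι => ℂ) ∞ → G.P → ℂ} {U₀ : E}
    {explZ : ℕ → E → (doubleCarriers C₀).Dom → ℝ}
    (h0 : ∀ g ∈ W, ∀ (U : E) (X : (doubleCarriers C₀).Dom), (doubleCarriers C₀).scale X = 0 → Ef g U X = 0)
    (hAdm : AdmissibleTerms Ef W Adm) (hres : AdmRestrict Adm) (hadd : ChannelAdditive Adm T) (hloc : ChannelLocal Adm T)
    (hstep : ChannelSizeAtStepNN Adm T κ wt τ) (hfac : Factorises Ef W T (ΨOf G act wt U₀ explZ))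
    (hsmul : ∀ (c : ℝ), ∀ H ∈ Adm, c • H ∈ Adm) (hne : Adm.Nonempty) (hwt : ∀ m y, 0 < wt m y)
    (hτ : ∀ k j, j ≤ k → 0 ≤ τ k j ∧ τ k j ≤ τbar * ω ^ (k - j)) (hτbar : 0 < τbar) (hω : 0 ≤ ω) (hωh : 0 < ωh)
    (hωωh : ω ≤ ωh) {m : ℕ → ℝ → E → G.P → ℝ} {a d : G.P → ℝ} {δ : (doubleCarriers C₀).Dom → ℝ}
    {p₀ clip qT : ℕ → ℝ} {R₀ s₀ B pbar θ₀ θ clipbar qTbar : ℝ}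
    (hs₀ : 0 < s₀) (hsR : s₀ < R₀) (hB : 0 ≤ B) (hpbar : 0 ≤ pbar) (hθ₀1 : θ₀ < 1) (hθ0 : 0 < θ) (hθ1 : θ < 1)
    (hKP : G.PotentialKPG W act m a d R₀)
    (hkp2 : ∀ g ∈ W, ∀ (k : ℕ) (U : E) (X : (doubleCarriers C₀).Dom), (doubleCarriers C₀).scale X = k + 1 →
      ∀ γ ∈ G.vol X, ∑ γ' ∈ G.vol X with G.inc γ' γ, 2 * m k (g k) U γ' * Real.exp (a γ' + d γ') ≤ a γ)
    (hdec : G.DecayExtract δ d) (hpin : G.PinBudget a δ (fun _ => B) κ)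
    (hexplZ : ∀ (k : ℕ) (U : E) (X : (doubleCarriers C₀).Dom), (doubleCarriers C₀).scale X = k + 1 →
      |explZ k U X| ≤ Real.exp (-(κ * (doubleCarriers C₀).d X)) * p₀ k)
    (hp₀ : ∀ k, p₀ k ≤ pbar) (hclip0 : ∀ k, 0 ≤ clip k) (hclipb : ∀ k, clip k ≤ clipbar)
    (hCup : ∀ g ∈ W, ∀ g' ∈ W, ∀ (k : ℕ) (U : E) (X : (doubleCarriers C₀).Dom), (doubleCarriers C₀).scale X = k + 1 →
      ∀ Q ∈ ball (0 : lp (fun _ : ι => ℂ) ∞) s₀, ∀ γ ∈ G.vol X,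
        ‖act k (g k) U Q γ‖ ≤ m k (g' k) U γ ∧
          ‖act k (g k) U Q γ - act k (g' k) U Q γ‖ ≤ clip k * |g k - g' k| * m k (g' k) U γ)
    (hqT0 : ∀ k, 0 ≤ qT k) (hqTb : ∀ k, qT k ≤ qTbar)
    (hTcup : ∀ g ∈ W, ∀ g' ∈ W, ∀ (k : ℕ) (y : ι),
      |T k g (Ef g) y - T k g' (Ef g) y| ≤ wt k y * (qT k * |g k - g' k|))
    (hroom₀ : ωh * s₀ + τbar * (2 * B + pbar) ≤ θ₀ * s₀) (hroom : ωh * R₀ + τbar * (2 * B + pbar) ≤ θ * R₀) :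
    NE9 Ef W κ (prodModuli (1 / (1 - θ ^ 2) * (2 * clipbar * B + 2 * B / (R₀ - s₀) * qTbar)) fun _ => θ) ∧
      FadingMemory (1 / (1 - θ ^ 2) * (2 * clipbar * B + 2 * B / (R₀ - s₀) * qTbar) / θ) θ
        (prodModuli (1 / (1 - θ ^ 2) * (2 * clipbar * B + 2 * B / (R₀ - s₀) * qTbar)) fun _ => θ) :=
  ne9_and_fadingMemory_of_potentialKPG_coupling_twoRadii_SP_vac G h0 hAdm hres hadd hloc hstep hfac hsmul hne hwt hτ hτbar hω hωh
    hωωh hs₀ hsR hB hpbar hθ₀1 hθ0 hθ1 hKP hkp2 hdec hpin (fun k s Q U X => psiOf_eq_vac G act wt U₀ explZ k s Q U X) hexplZ hp₀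
    hclip0 hclipb hCup hqT0 hqTb hTcup hroom₀ hroom

end Record

/-! ## §3 Arithmetic: the two rooms at the refuter's letters (pure numbers, asserted of nothing) -/

/-- ARITHMETIC (PRICING-NE9 v11 F-v11-1, tables J∕L; pure numbers): at `R₀ = 1`, `ω̂ = 1∕13`, `τ̄·(2B + p̄₀) = 1∕2` the OUTER room
holds with `θ = 15∕26` (= `ω̂ + (1−ω̂)∕S`, S = 24∕13), while on the inner ball `s₀ = 19∕20` the INNER room needs
`θ₀ = 1∕13 + 10∕19 = 149∕247 > 15∕26` — the one-radius END reads `θ₀`, the two-radii END reads `θ`.  A READING of [II] p. 8 l. 9–10 ∕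
p. 21, asserted of nothing. [folklore] -/
example : (1 : ℝ) / 13 * 1 + 1 / 2 ≤ 15 / 26 * 1 ∧ (1 : ℝ) / 13 * (19 / 20) + 1 / 2 ≤ 149 / 247 * (19 / 20) ∧
    (15 : ℝ) / 26 < 149 / 247 := by
  refine ⟨by norm_num, by norm_num, by norm_num⟩

end Summit.QuantumFields.BalabanUV.T4Continuum.NE9HoloFamilyTwoRadiiEnd

end
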